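import Mathlib
import HarnessLib
import Literature.MathematicalPhysics.QuantumLattice.HubbardTwoPointMatsubaraLimit
import Literature.MathematicalPhysics.QuantumLattice.OrderedIntegralMarkedSplit

/-!
# Child `KLRegimeVolumeLimitV12` (stmt-HubbardSuperconductivity-19858), stub `stub_vl_bound`, input (H1): the GRASSMANN-SIDE REDUCTION of the
# τ-resolved two-point limit series to the two-time Dyson variables (seat hubbard-kl-k3c4-p2, g3; «Matsubara all-U route (R-a)»)

(H1) (k3c5-p1 g4, HOME/hubbard-kl-k3c5-p1/H1-DESIGN.md) identifies, for `s ∈ (0,β)`, the limit-determinant series of the Grassmann two-point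
numerator at external times `(s, 0)` (k3c5-p2's `tendsto_gaussExpect_twoPoint_mul_grassmannExp_allU_time`, p470680) with the Hamiltonian
two-time trace `e^{−βUL²/4}·Tr(e^{−(β−s)H′} c† e^{−sH′} c)/Tr e^{−βH₀}`, whose Dyson series (k3c5-p1's `hasSum_hubbard_twoPoint_twoTime_renormalised_trace`,
p484918) has, in order `N`, the pairs `(k, j)`, `k + j = N`, of ORDERED integrals over `u ∈ Δ_k((β−s)/β)` (vertices at operator times `−βu_i`,
i.e. Grassmann times `β(1−u_i) ∈ (s, β)`) and `u′ ∈ Δ_j(s/β)` (operator times `−(β−s) − βu′_l`, Grassmann times `s − βu′_l ∈ (0, s)`).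
This file moves the GRASSMANN order-`n` term into exactly these variables (design §2 C3, "integral plumbing"), independently of the pointwise
Wick/entry match (C2/C3-dictionary, k3c5-p1):

* §1 `twoPointTimeDet_perm`, `sum_twoPointTimeDet_perm` — the limit determinant with ARBITRARY external times `e : Fin 2 → ℝ` is invariant under
  joint relabelling of the vertices (t2's `twoPointLimitDet_perm` is `e = (0,0)`); `measurable_twoPointTimeDet`, `norm_twoPointTimeDet_le`,
  `integrableOn_sum_twoPointTimeDet_comp`;
* §2 **`sum_integral_twoPointTimeDet_eq_sum_marked`** — for `0 ≤ s ≤ β`, `0 < β`: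
  `Σ_x ∫_{[0,β]ⁿ} D_s(x,τ) dτ = βⁿ · n! · Σ_{k+j=n} ∫_{u ∈ Δ_k(1−s/β)} ∫_{u′ ∈ Δ_j(s/β)} Σ_x D_s(x, β(1 − (u ⧺ ((1−s/β) + u′))))`
  (scaling `τ = βv`, reflection `v = 1 − w`, cube → simplex by the symmetry of §1, then k3c5-p1's marked split
  `setIntegral_orderedSimplex_eq_sum_marked_of_integrableOn` at `a = 1 − s/β`), and the `((−1)ⁿ/n!)·Uⁿ`-normalised form
  **`twoPointTime_term_eq_sum_marked`** with the prefactor `(−β)ⁿ Uⁿ` of the Dyson side.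

What then remains of (H1) is pointwise on each open piece: `Σ_x D_s(x, β(1−(u ⧺ (a+u′)))) = (Z₀⁻¹·…)·Σ_{f,f′} Z₀·(C2's split-pair shifted Wick
determinant)` — k3c5-p1's C2 + entry dictionary.  Everything is proved; no definition; every real `U`.
-/

namespace Summit.HubbardSuperconductivity.HubbardSuperconductivity.Theorems.MatsubaraAllU

set_option linter.dupNamespace false -- summit = problem name (single-conjunct summit), D-0017

open MeasureTheory Finset Filter Topology Literature.MathematicalPhysics.QuantumLattice
  Literature.Probability.LatticeModels
open Literature.MathematicalPhysics.QuantumLattice.GrassmannAlgebra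
open scoped Nat ComplexOrder

noncomputable section

variable {L : ℕ} [NeZero L]

/-! ### §1 The limit determinant with arbitrary external times: relabelling symmetry, measurability, bounds -/

/-- **Joint relabelling of the vertices does not change the two-point limit determinant**, for ANY external times `e` (pair `0` fixed;
t2's `twoPointLimitDet_perm` is `e = (0, 0)`). -/
theorem twoPointTimeDet_perm (β μ : ℝ) (σ σ' : Fin 2) (xe ye : TorusSite 2 L) (e : Fin 2 → ℝ) {n : ℕ} (ρ : Equiv.Perm (Fin n))
    (x : Fin n → TorusSite 2 L) (τ : Fin n → ℝ) :
    (Matrix.of fun i j : Fin (n * 2 + 1) =>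
        vertexLimitEntry L β μ ((Fin.append (fun a => x (ρ a)) ![xe, ye] : Fin (n + 2) → TorusSite 2 L) (twoPointPlusEnum n σ i).1)
          ((Fin.append (fun a => x (ρ a)) ![xe, ye] : Fin (n + 2) → TorusSite 2 L) (twoPointMinusEnum n σ' j).1)
          (twoPointPlusEnum n σ i).2 (twoPointMinusEnum n σ' j).2
          ((Fin.append (fun a => τ (ρ a)) e : Fin (n + 2) → ℝ) (twoPointMinusEnum n σ' j).1 -
            (Fin.append (fun a => τ (ρ a)) e : Fin (n + 2) → ℝ) (twoPointPlusEnum n σ i).1)).det =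
      (Matrix.of fun i j : Fin (n * 2 + 1) =>
        vertexLimitEntry L β μ ((Fin.append x ![xe, ye] : Fin (n + 2) → TorusSite 2 L) (twoPointPlusEnum n σ i).1)
          ((Fin.append x ![xe, ye] : Fin (n + 2) → TorusSite 2 L) (twoPointMinusEnum n σ' j).1)
          (twoPointPlusEnum n σ i).2 (twoPointMinusEnum n σ' j).2
          ((Fin.append τ e : Fin (n + 2) → ℝ) (twoPointMinusEnum n σ' j).1 -
            (Fin.append τ e : Fin (n + 2) → ℝ) (twoPointPlusEnum n σ i).1)).det := by
  conv_rhs => rw [← Matrix.det_submatrix_equiv_self (twoPointPairPerm ρ)]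
  congr 1
  ext i j
  simp only [Matrix.submatrix_apply, Matrix.of_apply]
  refine Fin.cases ?_ (fun m => ?_) i <;> refine Fin.cases ?_ (fun m' => ?_) j <;>
    simp only [twoPointPairPerm_zero, twoPointPairPerm_succ, twoPointPlusEnum_zero, twoPointMinusEnum_zero,
      twoPointPlusEnum_succ, twoPointMinusEnum_succ, finProdFinEquiv_symm_pairPerm, Fin.append_left, Fin.append_right]

/-- **The vertex sum of the limit determinants is symmetric in the vertex times**, for any external times `e` and any equivariant
re-parametrisation `g` of the vertex times. -/
theorem sum_twoPointTimeDet_perm (β μ : ℝ) (σ σ' : Fin 2) (xe ye : TorusSite 2 L) (e : Fin 2 → ℝ) {n : ℕ}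
    (g : (Fin n → ℝ) → Fin n → ℝ) (hg : ∀ (ρ : Equiv.Perm (Fin n)) (w : Fin n → ℝ), g (fun a => w (ρ a)) = fun a => g w (ρ a))
    (ρ : Equiv.Perm (Fin n)) (w : Fin n → ℝ) :
    ∑ x : Fin n → TorusSite 2 L, (Matrix.of fun i j : Fin (n * 2 + 1) =>
        vertexLimitEntry L β μ ((Fin.append x ![xe, ye] : Fin (n + 2) → TorusSite 2 L) (twoPointPlusEnum n σ i).1)
          ((Fin.append x ![xe, ye] : Fin (n + 2) → TorusSite 2 L) (twoPointMinusEnum n σ' j).1)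
          (twoPointPlusEnum n σ i).2 (twoPointMinusEnum n σ' j).2
          ((Fin.append (g fun a => w (ρ a)) e : Fin (n + 2) → ℝ) (twoPointMinusEnum n σ' j).1 -
            (Fin.append (g fun a => w (ρ a)) e : Fin (n + 2) → ℝ) (twoPointPlusEnum n σ i).1)).det =
      ∑ x : Fin n → TorusSite 2 L, (Matrix.of fun i j : Fin (n * 2 + 1) =>
        vertexLimitEntry L β μ ((Fin.append x ![xe, ye] : Fin (n + 2) → TorusSite 2 L) (twoPointPlusEnum n σ i).1)
          ((Fin.append x ![xe, ye] : Fin (n + 2) → TorusSite 2 L) (twoPointMinusEnum n σ' j).1)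
          (twoPointPlusEnum n σ i).2 (twoPointMinusEnum n σ' j).2
          ((Fin.append (g w) e : Fin (n + 2) → ℝ) (twoPointMinusEnum n σ' j).1 -
            (Fin.append (g w) e : Fin (n + 2) → ℝ) (twoPointPlusEnum n σ i).1)).det := by
  rw [hg]
  rw [← (Equiv.arrowCongr ρ.symm (Equiv.refl (TorusSite 2 L))).sum_comp]
  refine sum_congr rfl fun x _ => ?_
  have hx : ((Equiv.arrowCongr ρ.symm (Equiv.refl (TorusSite 2 L))) x : Fin n → TorusSite 2 L) = fun a => x (ρ a) := by
    funext a; simp [Equiv.arrowCongr]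
  rw [hx]
  exact twoPointTimeDet_perm β μ σ σ' xe ye e ρ x (g w)

/-- The limit determinant with external times `e` is measurable in the vertex times. -/
theorem measurable_twoPointTimeDet (β μ : ℝ) (σ σ' : Fin 2) (xe ye : TorusSite 2 L) (e : Fin 2 → ℝ) {n : ℕ}
    (x : Fin n → TorusSite 2 L) :
    Measurable fun τ : Fin n → ℝ => (Matrix.of fun i j : Fin (n * 2 + 1) =>
        vertexLimitEntry L β μ ((Fin.append x ![xe, ye] : Fin (n + 2) → TorusSite 2 L) (twoPointPlusEnum n σ i).1)
          ((Fin.append x ![xe, ye] : Fin (n + 2) → TorusSite 2 L) (twoPointMinusEnum n σ' j).1)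
          (twoPointPlusEnum n σ i).2 (twoPointMinusEnum n σ' j).2
          ((Fin.append τ e : Fin (n + 2) → ℝ) (twoPointMinusEnum n σ' j).1 -
            (Fin.append τ e : Fin (n + 2) → ℝ) (twoPointPlusEnum n σ i).1)).det := by
  simp only [Matrix.det_apply', Matrix.of_apply]
  refine Finset.measurable_sum _ fun ρ _ => measurable_const.mul (Finset.measurable_prod _ fun i _ => ?_)
  refine (measurable_vertexLimitEntry β μ _ _ _ _).comp ?_
  exact ((measurable_pi_apply _).comp (continuous_append_const _).measurable).sub
    ((measurable_pi_apply _).comp (continuous_append_const _).measurable)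

/-- Bound on the limit determinant when ALL `n + 2` times lie in `[0, β]`: `‖D‖ ≤ ((2n+1)B₁²)^{n+1}`, `B₁ = L⁻² Σ_q e^{β|ξ_q|}`
(t2's `norm_twoPointLimitDet_le` with general external times `e ∈ [0,β]²`). -/
theorem norm_twoPointTimeDet_le {β : ℝ} (hβ : 0 ≤ β) (μ : ℝ) (σ σ' : Fin 2) (xe ye : TorusSite 2 L) {e : Fin 2 → ℝ}
    (he : ∀ p, e p ∈ Set.Icc (0 : ℝ) β) {n : ℕ} (x : Fin n → TorusSite 2 L) {τ : Fin n → ℝ}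
    (hτ : τ ∈ Set.Icc (0 : Fin n → ℝ) (fun _ => β)) :
    ‖(Matrix.of fun i j : Fin (n * 2 + 1) =>
        vertexLimitEntry L β μ ((Fin.append x ![xe, ye] : Fin (n + 2) → TorusSite 2 L) (twoPointPlusEnum n σ i).1)
          ((Fin.append x ![xe, ye] : Fin (n + 2) → TorusSite 2 L) (twoPointMinusEnum n σ' j).1)
          (twoPointPlusEnum n σ i).2 (twoPointMinusEnum n σ' j).2
          ((Fin.append τ e : Fin (n + 2) → ℝ) (twoPointMinusEnum n σ' j).1 -
            (Fin.append τ e : Fin (n + 2) → ℝ) (twoPointPlusEnum n σ i).1)).det‖ ≤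
      (((n * 2 + 1 : ℕ) : ℝ) * ((1 / (L : ℝ) ^ 2) * ∑ q : TorusSite 2 L, Real.exp (β * |nambuXi L μ q|)) ^ 2) ^ (n + 1) := by
  have hL : (0 : ℝ) < (L : ℝ) ^ 2 := by
    have : (0 : ℝ) < L := by exact_mod_cast Nat.pos_of_ne_zero (NeZero.ne L)
    positivity
  have hB1 : 1 ≤ (1 / (L : ℝ) ^ 2) * ∑ q : TorusSite 2 L, Real.exp (β * |nambuXi L μ q|) := by
    have hcard : ((Fintype.card (TorusSite 2 L) : ℕ) : ℝ) = (L : ℝ) ^ 2 := by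
      rw [Fintype.card_pi, prod_const, ZMod.card, card_univ, Fintype.card_fin, Nat.cast_pow]
    have hsum : ∑ _q : TorusSite 2 L, (1 : ℝ) ≤ ∑ q : TorusSite 2 L, Real.exp (β * |nambuXi L μ q|) :=
      sum_le_sum fun q _ => Real.one_le_exp (by positivity)
    rw [sum_const, card_univ, nsmul_eq_mul, hcard, mul_one] at hsum
    calc (1 : ℝ) = (1 / (L : ℝ) ^ 2) * (L : ℝ) ^ 2 := by rw [one_div_mul_cancel hL.ne']
      _ ≤ _ := by gcongr
  have h1 : 1 ≤ ((n * 2 + 1 : ℕ) : ℝ) *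
      ((1 / (L : ℝ) ^ 2) * ∑ q : TorusSite 2 L, Real.exp (β * |nambuXi L μ q|)) ^ 2 := by
    have : (1 : ℝ) ≤ ((n * 2 + 1 : ℕ) : ℝ) := by exact_mod_cast Nat.succ_le_succ (Nat.zero_le _)
    nlinarith
  refine norm_det_le_of_entry_le_odd _ h1 fun i j => ?_
  rw [Matrix.of_apply]
  refine norm_vertexLimitEntry_le β μ _ _ _ _ ?_
  have hall : ∀ r : Fin (n + 2), 0 ≤ (Fin.append τ e : Fin (n + 2) → ℝ) r ∧ (Fin.append τ e : Fin (n + 2) → ℝ) r ≤ β := by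
    intro r
    refine Fin.addCases (fun i => ?_) (fun j => ?_) r
    · rw [Fin.append_left]; exact ⟨hτ.1 i, hτ.2 i⟩
    · rw [Fin.append_right]; exact ⟨(he j).1, (he j).2⟩
  rw [abs_le]
  constructor <;> linarith [(hall (twoPointPlusEnum n σ i).1).1, (hall (twoPointPlusEnum n σ i).1).2,
    (hall (twoPointMinusEnum n σ' j).1).1, (hall (twoPointMinusEnum n σ' j).1).2]

/-- The vertex sum of the limit determinants, composed with a measurable re-parametrisation of the vertex times that keeps them in
`[0,β]` on a set `S` of finite measure, is integrable on `S` (bounded measurable on a finite-measure set). -/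
theorem integrableOn_sum_twoPointTimeDet_comp {β : ℝ} (hβ : 0 ≤ β) (μ : ℝ) (σ σ' : Fin 2) (xe ye : TorusSite 2 L)
    {e : Fin 2 → ℝ} (he : ∀ p, e p ∈ Set.Icc (0 : ℝ) β) {n m : ℕ} {g : (Fin m → ℝ) → Fin n → ℝ} (hg : Measurable g)
    {S : Set (Fin m → ℝ)} (hS : MeasurableSet S) (hSfin : volume S ≠ ⊤)
    (hgS : ∀ w ∈ S, g w ∈ Set.Icc (0 : Fin n → ℝ) (fun _ => β)) :
    IntegrableOn (fun w : Fin m → ℝ => ∑ x : Fin n → TorusSite 2 L, (Matrix.of fun i j : Fin (n * 2 + 1) =>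
        vertexLimitEntry L β μ ((Fin.append x ![xe, ye] : Fin (n + 2) → TorusSite 2 L) (twoPointPlusEnum n σ i).1)
          ((Fin.append x ![xe, ye] : Fin (n + 2) → TorusSite 2 L) (twoPointMinusEnum n σ' j).1)
          (twoPointPlusEnum n σ i).2 (twoPointMinusEnum n σ' j).2
          ((Fin.append (g w) e : Fin (n + 2) → ℝ) (twoPointMinusEnum n σ' j).1 -
            (Fin.append (g w) e : Fin (n + 2) → ℝ) (twoPointPlusEnum n σ i).1)).det) S volume := by
  refine integrableOn_of_measurable_of_norm_le hS hSfin
    (Finset.measurable_sum _ fun x _ => (measurable_twoPointTimeDet β μ σ σ' xe ye e x).comp hg)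
    (B := ∑ _x : Fin n → TorusSite 2 L, (((n * 2 + 1 : ℕ) : ℝ) *
      ((1 / (L : ℝ) ^ 2) * ∑ q : TorusSite 2 L, Real.exp (β * |nambuXi L μ q|)) ^ 2) ^ (n + 1))
    fun w hw => (norm_sum_le _ _).trans (sum_le_sum fun x _ => norm_twoPointTimeDet_le hβ μ σ σ' xe ye he x (hgS w hw))

/-! ### §2 The Grassmann order-`n` term in the two-time Dyson variables -/

/-- **THE GRASSMANN ORDER-`n` TERM IN THE TWO-TIME DYSON VARIABLES** (`0 < β`, `0 ≤ s ≤ β`, external times `(s, 0)`):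
`Σ_x ∫_{[0,β]ⁿ} D_s(x,τ) dτ = βⁿ · n! · Σ_{k+j=n} ∫_{u ∈ Δ_k(1−s/β)} ∫_{u′ ∈ Δ_j(1−(1−s/β))} Σ_x D_s(x, β(1 − (u ⧺ ((1−s/β) + u′))))`
— scaling `τ = βv`, reflection `v = 1 − w`, cube → simplex (relabelling symmetry), marked split at `a = 1 − s/β`.  In the summand the first
`k` Grassmann vertex times `β(1−u_i)` lie in `[s, β]` (operator times `−βu_i`, the block between `Y` at `0` and `X` at `−(β−s)`), the last `j`
ones `β(1−(1−s/β)−u′_l) = s − βu′_l` lie in `[0, s]` (operator times `−(β−s) − βu′_l`) — exactly the variables of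
`hasSum_hubbard_twoPoint_twoTime_renormalised_trace`. -/
theorem sum_integral_twoPointTimeDet_eq_sum_marked {β : ℝ} (hβ : 0 < β) (μ : ℝ) (σ σ' : Fin 2) (xe ye : TorusSite 2 L)
    {s : ℝ} (hs0 : 0 ≤ s) (hsβ : s ≤ β) (n : ℕ) :
    ∑ x : Fin n → TorusSite 2 L, ∫ τ in Set.Icc (0 : Fin n → ℝ) (fun _ => β), (Matrix.of fun i j : Fin (n * 2 + 1) =>
        vertexLimitEntry L β μ ((Fin.append x ![xe, ye] : Fin (n + 2) → TorusSite 2 L) (twoPointPlusEnum n σ i).1)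
          ((Fin.append x ![xe, ye] : Fin (n + 2) → TorusSite 2 L) (twoPointMinusEnum n σ' j).1)
          (twoPointPlusEnum n σ i).2 (twoPointMinusEnum n σ' j).2
          ((Fin.append τ ![s, 0] : Fin (n + 2) → ℝ) (twoPointMinusEnum n σ' j).1 -
            (Fin.append τ ![s, 0] : Fin (n + 2) → ℝ) (twoPointPlusEnum n σ i).1)).det =
      (β : ℂ) ^ n * ((n ! : ℂ) * ∑ kj ∈ Finset.HasAntidiagonal.antidiagonal n, if h : kj.1 + kj.2 = n then
        ∫ u in {w : Fin kj.1 → ℝ | (∀ i, w i ∈ Set.Icc (0 : ℝ) (1 - s / β)) ∧ Monotone w},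
          ∫ u' in {w : Fin kj.2 → ℝ | (∀ i, w i ∈ Set.Icc (0 : ℝ) (1 - (1 - s / β))) ∧ Monotone w},
            ∑ x : Fin n → TorusSite 2 L, (Matrix.of fun i j : Fin (n * 2 + 1) =>
        vertexLimitEntry L β μ ((Fin.append x ![xe, ye] : Fin (n + 2) → TorusSite 2 L) (twoPointPlusEnum n σ i).1)
          ((Fin.append x ![xe, ye] : Fin (n + 2) → TorusSite 2 L) (twoPointMinusEnum n σ' j).1)
          (twoPointPlusEnum n σ i).2 (twoPointMinusEnum n σ' j).2
          ((Fin.append (fun a : Fin n => β * (1 - Fin.append u (fun l => (1 - s / β) + u' l) (Fin.cast h.symm a))) ![s, 0] : Fin (n + 2) → ℝ) (twoPointMinusEnum n σ' j).1 -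
            (Fin.append (fun a : Fin n => β * (1 - Fin.append u (fun l => (1 - s / β) + u' l) (Fin.cast h.symm a))) ![s, 0] : Fin (n + 2) → ℝ) (twoPointPlusEnum n σ i).1)).det
        else 0) := by
  have he : ∀ p : Fin 2, (![s, 0] : Fin 2 → ℝ) p ∈ Set.Icc (0 : ℝ) β := by
    intro p; fin_cases p
    · exact ⟨hs0, hsβ⟩
    · exact ⟨le_rfl, hβ.le⟩
  -- the integrand as a function of the vertex times
  set F : (Fin n → ℝ) → ℂ := fun τ => ∑ x : Fin n → TorusSite 2 L, (Matrix.of fun i j : Fin (n * 2 + 1) =>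
        vertexLimitEntry L β μ ((Fin.append x ![xe, ye] : Fin (n + 2) → TorusSite 2 L) (twoPointPlusEnum n σ i).1)
          ((Fin.append x ![xe, ye] : Fin (n + 2) → TorusSite 2 L) (twoPointMinusEnum n σ' j).1)
          (twoPointPlusEnum n σ i).2 (twoPointMinusEnum n σ' j).2
          ((Fin.append τ ![s, 0] : Fin (n + 2) → ℝ) (twoPointMinusEnum n σ' j).1 -
            (Fin.append τ ![s, 0] : Fin (n + 2) → ℝ) (twoPointPlusEnum n σ i).1)).det with hF
  -- (1) sum inside the integral
  have hswap : ∑ x : Fin n → TorusSite 2 L, ∫ τ in Set.Icc (0 : Fin n → ℝ) (fun _ => β), (Matrix.of fun i j : Fin (n * 2 + 1) =>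
        vertexLimitEntry L β μ ((Fin.append x ![xe, ye] : Fin (n + 2) → TorusSite 2 L) (twoPointPlusEnum n σ i).1)
          ((Fin.append x ![xe, ye] : Fin (n + 2) → TorusSite 2 L) (twoPointMinusEnum n σ' j).1)
          (twoPointPlusEnum n σ i).2 (twoPointMinusEnum n σ' j).2
          ((Fin.append τ ![s, 0] : Fin (n + 2) → ℝ) (twoPointMinusEnum n σ' j).1 -
            (Fin.append τ ![s, 0] : Fin (n + 2) → ℝ) (twoPointPlusEnum n σ i).1)).det =
      ∫ τ in Set.Icc (0 : Fin n → ℝ) (fun _ => β), F τ := by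
    rw [hF, integral_finsetSum]
    intro x _
    exact integrableOn_of_measurable_of_norm_le measurableSet_Icc (Literature.Analysis.Matrix.volume_Icc_cube_ne_top β)
      (measurable_twoPointTimeDet β μ σ σ' xe ye _ x) fun τ hτ => norm_twoPointTimeDet_le hβ.le μ σ σ' xe ye he x hτ
  -- (2) scaling and reflection
  have hscale := setIntegral_Icc_eq_pow_mul_setIntegral_unit_cube (k := n) hβ F
  have hrefl := (setIntegral_unit_cube_comp_one_sub (fun w : Fin n → ℝ => F (β • w))).symm
  have hdef : (fun u : Fin n → ℝ => F (β • fun i => 1 - u i)) = fun u : Fin n → ℝ => F (fun a => β * (1 - u a)) := rfl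
  -- (3) cube → simplex by the relabelling symmetry
  have hmeas_g : Measurable fun u : Fin n → ℝ => (fun a => β * (1 - u a) : Fin n → ℝ) :=
    measurable_pi_iff.2 fun a => measurable_const.mul (measurable_const.sub (measurable_pi_apply a))
  have hg_range : ∀ u ∈ Set.pi Set.univ (fun _ : Fin n => Set.Icc (0 : ℝ) 1),
      (fun a => β * (1 - u a) : Fin n → ℝ) ∈ Set.Icc (0 : Fin n → ℝ) (fun _ => β) := by
    intro u hu
    rw [Set.mem_univ_pi] at hu
    refine ⟨fun a => ?_, fun a => ?_⟩
    · have := (hu a).2; simp only [Pi.zero_apply]; nlinarith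
    · have := (hu a).1; nlinarith
  have hInt_cube : IntegrableOn (fun u : Fin n → ℝ => F (fun a => β * (1 - u a)))
      (Set.pi Set.univ fun _ : Fin n => Set.Icc (0 : ℝ) 1) volume := by
    simp only [hF]
    exact integrableOn_sum_twoPointTimeDet_comp hβ.le μ σ σ' xe ye he hmeas_g (MeasurableSet.univ_pi fun _ => measurableSet_Icc)
      ((isCompact_cube n 1).measure_lt_top.ne) hg_range
  have hsym : ∀ (ρ : Equiv.Perm (Fin n)) (w : Fin n → ℝ),
      F (fun a => β * (1 - (fun i => w (ρ i)) a)) = F (fun a => β * (1 - w a)) := by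
    intro ρ w
    simp only [hF]
    exact sum_twoPointTimeDet_perm β μ σ σ' xe ye ![s, 0] (fun w : Fin n → ℝ => fun a => β * (1 - w a)) (fun ρ w => rfl) ρ w
  have hsymm := setIntegral_cube_eq_factorial_mul_setIntegral_simplex n 1 (fun u : Fin n → ℝ => F (fun a => β * (1 - u a))) hsym hInt_cube
  -- (4) the marked split of the simplex at `a = 1 - s/β`
  have ha : 0 ≤ 1 - s / β := by
    rw [sub_nonneg, div_le_one hβ]; exact hsβ
  have hat : 1 - s / β ≤ 1 := by
    have : 0 ≤ s / β := div_nonneg hs0 hβ.le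
    linarith
  have hInt_simplex : IntegrableOn (fun u : Fin n → ℝ => F (fun a => β * (1 - u a)))
      {w : Fin n → ℝ | (∀ i, w i ∈ Set.Icc (0 : ℝ) 1) ∧ Monotone w} volume :=
    hInt_cube.mono_set (simplex_subset_cube n 1)
  have hsplit := setIntegral_orderedSimplex_eq_sum_marked_of_integrableOn n ha hat
    (fun u : Fin n → ℝ => F (fun a => β * (1 - u a))) hInt_simplex
  -- assemble
  rw [hswap, hscale, hrefl, hdef, hsymm, hsplit]

/-- **The normalised Grassmann order-`n` term** (the summand of the two-point limit series, `((−1)ⁿ/n!)·Uⁿ·Σ_x∫_{[0,β]ⁿ} D_s`) **in the two-time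
Dyson variables**: `= Uⁿ · (−β)ⁿ · Σ_{k+j=n} ∫_{Δ_k(1−s/β)}∫_{Δ_j(1−(1−s/β))} Σ_x D_s(x, β(1 − (u ⧺ ((1−s/β)+u′))))` — the prefactor `Uⁿ(−β)ⁿ`
is the one of `hasSum_hubbard_twoPoint_twoTime_renormalised_trace`'s `N`-th term. -/
theorem twoPointTime_term_eq_sum_marked {β : ℝ} (hβ : 0 < β) (μ U : ℝ) (σ σ' : Fin 2) (xe ye : TorusSite 2 L)
    {s : ℝ} (hs0 : 0 ≤ s) (hsβ : s ≤ β) (n : ℕ) :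
    ((-1 : ℂ) ^ n * ((n ! : ℂ))⁻¹) * ((U : ℂ) ^ n * ∑ x : Fin n → TorusSite 2 L,
        ∫ τ in Set.Icc (0 : Fin n → ℝ) (fun _ => β), (Matrix.of fun i j : Fin (n * 2 + 1) =>
        vertexLimitEntry L β μ ((Fin.append x ![xe, ye] : Fin (n + 2) → TorusSite 2 L) (twoPointPlusEnum n σ i).1)
          ((Fin.append x ![xe, ye] : Fin (n + 2) → TorusSite 2 L) (twoPointMinusEnum n σ' j).1)
          (twoPointPlusEnum n σ i).2 (twoPointMinusEnum n σ' j).2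
          ((Fin.append τ ![s, 0] : Fin (n + 2) → ℝ) (twoPointMinusEnum n σ' j).1 -
            (Fin.append τ ![s, 0] : Fin (n + 2) → ℝ) (twoPointPlusEnum n σ i).1)).det) =
      (U : ℂ) ^ n * ((-(β : ℂ)) ^ n * ∑ kj ∈ Finset.HasAntidiagonal.antidiagonal n, if h : kj.1 + kj.2 = n then
        ∫ u in {w : Fin kj.1 → ℝ | (∀ i, w i ∈ Set.Icc (0 : ℝ) (1 - s / β)) ∧ Monotone w},
          ∫ u' in {w : Fin kj.2 → ℝ | (∀ i, w i ∈ Set.Icc (0 : ℝ) (1 - (1 - s / β))) ∧ Monotone w},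
            ∑ x : Fin n → TorusSite 2 L, (Matrix.of fun i j : Fin (n * 2 + 1) =>
        vertexLimitEntry L β μ ((Fin.append x ![xe, ye] : Fin (n + 2) → TorusSite 2 L) (twoPointPlusEnum n σ i).1)
          ((Fin.append x ![xe, ye] : Fin (n + 2) → TorusSite 2 L) (twoPointMinusEnum n σ' j).1)
          (twoPointPlusEnum n σ i).2 (twoPointMinusEnum n σ' j).2
          ((Fin.append (fun a : Fin n => β * (1 - Fin.append u (fun l => (1 - s / β) + u' l) (Fin.cast h.symm a))) ![s, 0] : Fin (n + 2) → ℝ) (twoPointMinusEnum n σ' j).1 -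
            (Fin.append (fun a : Fin n => β * (1 - Fin.append u (fun l => (1 - s / β) + u' l) (Fin.cast h.symm a))) ![s, 0] : Fin (n + 2) → ℝ) (twoPointPlusEnum n σ i).1)).det
        else 0) := by
  rw [sum_integral_twoPointTimeDet_eq_sum_marked hβ μ σ σ' xe ye hs0 hsβ n]
  have hfac : (n ! : ℂ) ≠ 0 := by exact_mod_cast n.factorial_ne_zero
  -- abbreviate the common sum
  set S : ℂ := ∑ kj ∈ Finset.HasAntidiagonal.antidiagonal n, _ with hS
  rw [neg_pow]
  field_simp
  ring

end

end Summit.HubbardSuperconductivity.HubbardSuperconductivity.Theorems.MatsubaraAllU
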